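import Mathlib
import Literature.NumberTheory.GaloisRepresentations.GlobalTriangulineSpace
import Literature.NumberTheory.GaloisRepresentations.UniversalFramedDeformationRing
import Literature.NumberTheory.GaloisRepresentations.NearlyOrdinaryDeformationRing

/-!
# Sketch — first lemmas of three crux ideas for `ProModularOfGKBound`
(crux-ideate round 1, ideator 2; statements only, proofs deliberately `sorry`).
-/

open Literature.NumberTheory.GaloisRepresentations
open IsDedekindDomain NumberField Field
open scoped ValuativeRel

namespace Summit.Langlands.Langlands.Cruxes.ProModularOfGKBound.Sketch

universe u

/-! ## Card `two-leaf-fern` — the two-leaf spanning criterion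
`T_L ⊔ T_{L'} = T_⊤` for two families of local tangent conditions at the places of `Sp`
(intended: `L_v, L'_v` = tangent spaces of the trianguline variety at the two OPPOSITE
refinements of `ρ_z|Γ_{F_v}`, `ρ_z` a non-CM classical residually-Eisenstein point).  The two
hypotheses are the inputs of the line: `hcap` = (local fact `H¹_tri,R ∩ H¹_tri,R^opp = H¹_f`,
Nakamura) + (adjoint Bloch–Kato Selmer vanishing, Newton–Thorne Thm 2); `hdim` = the two
Greenberg–Wiles counts `dim T_L = dim T_{L'} = d`, `dim T_⊤ = 2d`. -/
theorem twoLeaf_span {K : Type u} [Field K] [NumberField K] {E : Type u} [Field E]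
    [TopologicalSpace E] [IsTopologicalRing E] {n : ℕ}
    (S : Set (HeightOneSpectrum (𝓞 K))) {Sp : Set (HeightOneSpectrum (𝓞 K))}
    (ρ : FramedGaloisRep K E n)
    (L L' : ∀ v : Sp, Submodule E ((FramedRep.adjoint (ρ.toLocal v.1)).H 1))
    [FiniteDimensional E (ρ.tangentSpaceWith S (Sp := Sp) (fun _ => ⊤))]
    (hcap : ρ.tangentSpaceWith S (fun v => L v ⊓ L' v) = ⊥)
    (hdim : Module.finrank E (ρ.tangentSpaceWith S L) + Module.finrank E (ρ.tangentSpaceWith S L')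
        = Module.finrank E (ρ.tangentSpaceWith S (Sp := Sp) (fun _ => ⊤))) :
    ρ.tangentSpaceWith S L ⊔ ρ.tangentSpaceWith S L'
      = ρ.tangentSpaceWith S (Sp := Sp) (fun _ => ⊤) := by
  sorry

/-! ## Card `krull-seed` — ordinarity is cut out by `[F_v:ℚ_p]` equations in the FRAMED
deformation ring of a NON-SPLIT, `p`-distinguished, generic reducible `ρ̄_v : Γ_{K} → GL₂(k)`
(`K/ℚ_p` finite).  Stated over the tree's universal framed deformation ring
(`Deformation.exists_universalFramedDeformationRing`): for any universal pair `(R, ρ_R)` there is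
a finite set `s ⊆ R` of at most `f = log_p #𝓀` elements such that a morphism `φ : R → A` kills `s`
iff the specialised lift is reducible (`Deformation.IsReducible`: conjugate to upper-triangular). -/
theorem reducibleLocus_cutOut {K : Type u} [Field K] [ValuativeRel K] [TopologicalSpace K]
    [IsNonarchimedeanLocalField K] [CharZero K]
    {𝒪 : Type u} [CommRing 𝒪] [IsNoetherianRing 𝒪] {k : Type u} [Field k] [Algebra 𝒪 k] [Finite k]
    (p f : ℕ) [Fact p.Prime] (hK : 𝓂[K] = Ideal.span {(p : 𝒪[K])}) (hf : Nat.card 𝓀[K] = p ^ f)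
    [CharP k p]
    (χ₁ χ₂ : absoluteGaloisGroup K →* kˣ) (c : absoluteGaloisGroup K → k)
    (rbar : absoluteGaloisGroup K →* GL (Fin 2) k)
    (hrbar : ∀ σ, (rbar σ).val = !![(χ₁ σ : k), c σ; 0, (χ₂ σ : k)])
    (hopen : IsOpen (rbar.ker : Set (absoluteGaloisGroup K)))
    (hdist : χ₁ ≠ χ₂)                                   -- p-distinguished
    (hnonsplit : ¬ ∃ a : k, ∀ σ, c σ = a * ((χ₂ σ : k) - (χ₁ σ : k)))  -- the extension is non-split
    (ω : absoluteGaloisGroup K →* kˣ)   -- intended: the mod-p cyclotomic character of Γ_K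
    (hgen : χ₁ * χ₂⁻¹ ≠ ω ∧ χ₂ * χ₁⁻¹ ≠ ω)   -- genericity (then R^□ and R^{□,ord} are formally smooth)
    (R : Deformation.CNLAlgebra 𝒪 k) (ρR : absoluteGaloisGroup K →* GL (Fin 2) R)
    (huniv : ∀ (A : Deformation.CNLAlgebra 𝒪 k) (ρ : absoluteGaloisGroup K →* GL (Fin 2) A),
        Deformation.IsAdicContinuous ρ →
        (Matrix.GeneralLinearGroup.map (A.residue : A →+* k)).comp ρ = rbar →
          ∃! φ : R →ₐ[𝒪] A, (Matrix.GeneralLinearGroup.map (φ : R →+* A)).comp ρR = ρ)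
    (hres : (Matrix.GeneralLinearGroup.map (R.residue : R →+* k)).comp ρR = rbar) :
    ∃ s : Finset R, s.card ≤ f ∧
      ∀ (A : Deformation.CNLAlgebra 𝒪 k) (φ : R →ₐ[𝒪] A),
        (∀ x ∈ s, φ x = 0) ↔
          Deformation.IsReducible ((Matrix.GeneralLinearGroup.map (φ : R →+* A)).comp ρR) := by
  sorry

/-! ## Card `gk-additivity` — the finite-level avatar of "total ≤ base + special fibre":
for a finite-dimensional `k`-space `V` (intended: `S(U^p K_r, k)_𝔪`) and a commutative LOCAL
`k`-subalgebra `A ⊆ End_k V` (intended: the image of the Hecke algebra), `dim V ≤ dim A · dim V[𝔪_A]`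
(socle/`𝔪`-adic filtration).  With `dim S_{r,𝔪} ≍ p^{3dr}` (freeness over `k[K₀/K_r]`) and the
door `dim S_r[𝔪] ≤ C p^{dr}` this gives `dim_k 𝕋_{r,𝔪} ≥ c p^{2dr}`, i.e. `dim 𝕋_𝔪 ≥ 1+2[F:ℚ]`. -/
theorem finrank_le_finrank_alg_mul_finrank_torsion {k V A : Type u} [Field k] [AddCommGroup V]
    [Module k V] [FiniteDimensional k V]
    [CommRing A] [Algebra k A] [IsLocalRing A] [Module A V] [IsScalarTower k A V]
    [FiniteDimensional k A]
    (W : Submodule k V) (hW : ∀ v, v ∈ W ↔ ∀ a ∈ IsLocalRing.maximalIdeal A, a • v = 0) :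
    Module.finrank k V ≤ Module.finrank k A * Module.finrank k W := by
  sorry

end Summit.Langlands.Langlands.Cruxes.ProModularOfGKBound.Sketch
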